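import Mathlib
import HarnessLib
import Summits.ValiantsHypothesis.ValiantsHypothesis.Theses.PermanentalCones
import Summits.ValiantsHypothesis.ValiantsHypothesis.Theorems.PermanentalConesHyperbolicVPShadowBlockCases
import Literature.AlgebraicGeometry.HyperbolicPolynomials.SpectrahedralShadow

/-!
# ValiantsHypothesis / PermanentalCones — `HyperbolicVPShadow`, stub B reduces to IRREDUCIBLE
# real-spectrum matrix spaces

Route `PermanentalCones`, item `stmt-ValiantsHypothesis-8655` (crux `HyperbolicVPShadow`), line
`birth`, stub `stub_realSpectrumShadow` (stub B = crux #3 `HyperbolicDetShadow` in linear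
real-spectrum normal form): for an absolute `c`, every linear pencil `P : ℝⁿ →ₗ Mat_N(ℝ)` with
only real eigenvalues should have a closed nonnegative-spectrum cone
`{x : ∀ τ > 0, det (P x + τ·1) ≠ 0}` that is a lifted-LMI set of size `≤ 2^((log₂ N + c)^c)`.

Main result (`permanentalCones_realSpectrumShadow_of_irreducible`): **it suffices to prove stub B
for IRREDUCIBLE pencils** — those for which no subspace `0 ≠ W ≠ ℝ^N` is invariant under every
`P x` — with the SAME shape of bound (`c ↦ c + 2`). The conclusion is the registered signature of
`stub_realSpectrumShadow` verbatim, so a proof of the irreducible case closes the stub (and with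
the landed bridges, cruxes #3 and #5 of the route).

Proof. Strong induction on `N` with the intermediate bound `N · 2^((log₂ N + c)^c)`:
* `N = 0`: the cone is everything, size `0` (`permanentalCones_realSpectrumShadow_zero`);
* reducible, `0 ≠ W ≠ ℝ^N` invariant: in a basis adapted to `W ⊕ W'` (`W'` any complement) the
  pencil is block upper triangular with LINEAR diagonal pencils of sizes `dim W`, `N − dim W`,
  both `< N` (`permanentalCones_exists_blockTriangular_of_invariant`: change of basis via
  `Basis.toMatrix`, the `(W', W)` block vanishes because `W`-vectors have no `W'`-coordinates);
  the diagonal pencils inherit the real spectrum and the cone is the intersection of their cones,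
  sizes adding (`…BlockCases`: `permanentalCones_realSpectrum_blockTriangular_iff`,
  `permanentalCones_realSpectrumShadow_blockTriangular`); `N₁·B + N₂·B ≤ N·B` by monotonicity of
  `log₂`;
* irreducible: the hypothesis, and `2^(…) ≤ N · 2^(…)` for `N ≥ 1`;
* finally `N · 2^((log₂ N + c)^c) ≤ 2^((log₂ N + c + 2)^(c+2))` (`permanentalCones_mul_qp_le_qp`,
  from `N < 2^(log₂ N + 1)`).

Combined with the symmetrisable case of `…BlockCases` (size `N`),
`permanentalCones_realSpectrumShadow_of_irreducible_nonsymmetrizable` sharpens the hypothesis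
further: stub B follows from its case for pencils that are irreducible AND admit no positive
definite common symmetriser. So the open core of stub B / `HyperbolicDetShadow` is exactly:
irreducible, not simultaneously symmetrisable linear spaces of real matrices with only real
eigenvalues (none exist for `N ≤ 2`). All statements are folklore linear algebra.
-/

-- `<Problem> = <Summit>` for this single-conjunct summit (lakefile sets the same option tree-wide).
set_option linter.dupNamespace false

noncomputable section

namespace Summit.ValiantsHypothesis.ValiantsHypothesis.Theorems

open Matrix
open Literature.AlgebraicGeometry.HyperbolicPolynomials

/-! ### Block-triangularisation along an invariant subspace -/

/-- **Adapted bases.** If a subspace `W ⊆ ℝ^N` is invariant under every value of a linear pencil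
`P`, then after one change of basis (`S`, and a reindexing `e` of `Fin N₁ ⊕ Fin N₂`,
`N₁ = dim W`) the pencil is block upper triangular, with LINEAR diagonal pencils `P₁` (the
restriction to `W`) and `P₂` (the induced pencil on `ℝ^N / W`). [folklore] -/
theorem permanentalCones_exists_blockTriangular_of_invariant {n N : ℕ}
    (P : (Fin n → ℝ) →ₗ[ℝ] Matrix (Fin N) (Fin N) ℝ) (W : Submodule ℝ (Fin N → ℝ))
    (hW : ∀ (x : Fin n → ℝ), ∀ v ∈ W, (P x) *ᵥ v ∈ W) :
    ∃ (N₁ N₂ : ℕ)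
      (P₁ : (Fin n → ℝ) →ₗ[ℝ] Matrix (Fin N₁) (Fin N₁) ℝ)
      (P₂ : (Fin n → ℝ) →ₗ[ℝ] Matrix (Fin N₂) (Fin N₂) ℝ)
      (Q : (Fin n → ℝ) → Matrix (Fin N₁) (Fin N₂) ℝ)
      (S : Matrix (Fin N) (Fin N) ℝ) (e : Fin N₁ ⊕ Fin N₂ ≃ Fin N),
      N₁ = Module.finrank ℝ W ∧ N₁ + N₂ = N ∧ IsUnit S ∧
      ∀ x, P x = S * Matrix.reindex e e (fromBlocks (P₁ x) (Q x) 0 (P₂ x)) * S⁻¹ := by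
  classical
  obtain ⟨W', hWW'⟩ := W.exists_isCompl
  set N₁ := Module.finrank ℝ W with hN₁
  set N₂ := Module.finrank ℝ W' with hN₂
  set φ : (W × W') ≃ₗ[ℝ] (Fin N → ℝ) := Submodule.prodEquivOfIsCompl W W' hWW' with hφ
  have hsum : N₁ + N₂ = N := by
    rw [hN₁, hN₂, ← Module.finrank_prod, φ.finrank_eq, Module.finrank_fin_fun]
  set bW : Module.Basis (Fin N₁) ℝ W := Module.finBasis ℝ W with hbW
  set bW' : Module.Basis (Fin N₂) ℝ W' := Module.finBasis ℝ W' with hbW'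
  set e : Fin N₁ ⊕ Fin N₂ ≃ Fin N := finSumFinEquiv.trans (finCongr hsum) with he
  set b : Module.Basis (Fin N₁ ⊕ Fin N₂) ℝ (Fin N → ℝ) := (bW.prod bW').map φ with hb
  set b' : Module.Basis (Fin N) ℝ (Fin N → ℝ) := b.reindex e with hb'
  set s : Module.Basis (Fin N) ℝ (Fin N → ℝ) := Pi.basisFun ℝ (Fin N) with hs
  set S : Matrix (Fin N) (Fin N) ℝ := s.toMatrix b' with hS
  have hSS' : S * b'.toMatrix s = 1 := s.toMatrix_mul_toMatrix_flip b'
  have hSdet : IsUnit S.det := Matrix.isUnit_det_of_right_inverse hSS'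
  have hSu : IsUnit S := (Matrix.isUnit_iff_isUnit_det S).2 hSdet
  have hSinv : S⁻¹ = b'.toMatrix s := Matrix.inv_eq_right_inv hSS'
  -- the matrix of `P x` in the adapted basis `b'` is `S⁻¹ · P x · S`
  have hM : ∀ x, S⁻¹ * (P x * S) = LinearMap.toMatrix b' b' (Matrix.toLin s s (P x)) := by
    intro x
    have h := basis_toMatrix_mul_linearMap_toMatrix_mul_basis_toMatrix (b := b') (b' := s)
      (c := b') (c' := s) (Matrix.toLin s s (P x))
    rw [LinearMap.toMatrix_toLin] at h
    rw [hSinv, ← h, hS, Matrix.mul_assoc]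
  -- vectors of `W` have no `W'`-coordinates
  have hreprW : ∀ w ∈ W, ∀ i : Fin N₂, b.repr w (Sum.inr i) = 0 := by
    intro w hw i
    have hφw : φ.symm w = ((⟨w, hw⟩ : W), (0 : W')) :=
      Submodule.prodEquivOfIsCompl_symm_apply_left W W' hWW' ⟨w, hw⟩
    rw [hb, Module.Basis.map_repr, LinearEquiv.trans_apply, hφw, Module.Basis.prod_repr_inr,
      map_zero, Finsupp.zero_apply]
  -- the first basis vectors lie in `W`
  have hbW_mem : ∀ j : Fin N₁, b (Sum.inl j) ∈ W := by
    intro j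
    rw [hb, Module.Basis.map_apply, hφ, Submodule.coe_prodEquivOfIsCompl',
      Module.Basis.prod_apply_inl_fst, Module.Basis.prod_apply_inl_snd, Submodule.coe_zero,
      add_zero]
    exact Submodule.coe_mem _
  -- hence the `(W', W)` block of the adapted matrix vanishes
  have hzero : ∀ x (i : Fin N₂) (j : Fin N₁),
      (S⁻¹ * (P x * S)) (e (Sum.inr i)) (e (Sum.inl j)) = 0 := by
    intro x i j
    rw [hM x, LinearMap.toMatrix_apply, hb', Module.Basis.reindex_apply,
      Module.Basis.repr_reindex_apply, Equiv.symm_apply_apply, Equiv.symm_apply_apply,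
      Matrix.toLin_eq_toLin', Matrix.toLin'_apply]
    exact hreprW _ (hW x _ (hbW_mem j)) i
  -- the adapted pencil, reindexed by `Fin N₁ ⊕ Fin N₂`, and its blocks (all linear in `x`)
  let T : Matrix (Fin N) (Fin N) ℝ →ₗ[ℝ] Matrix (Fin N₁ ⊕ Fin N₂) (Fin N₁ ⊕ Fin N₂) ℝ :=
    (Matrix.reindexLinearEquiv ℝ ℝ e.symm e.symm).toLinearMap ∘ₗ LinearMap.mulLeft ℝ S⁻¹ ∘ₗ
      LinearMap.mulRight ℝ S
  have hT : ∀ x, T (P x) = Matrix.reindex e.symm e.symm (S⁻¹ * (P x * S)) := fun x => rfl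
  let B₁₁ : Matrix (Fin N₁ ⊕ Fin N₂) (Fin N₁ ⊕ Fin N₂) ℝ →ₗ[ℝ] Matrix (Fin N₁) (Fin N₁) ℝ :=
    { toFun := fun M => M.toBlocks₁₁
      map_add' := fun _ _ => rfl
      map_smul' := fun _ _ => rfl }
  let B₂₂ : Matrix (Fin N₁ ⊕ Fin N₂) (Fin N₁ ⊕ Fin N₂) ℝ →ₗ[ℝ] Matrix (Fin N₂) (Fin N₂) ℝ :=
    { toFun := fun M => M.toBlocks₂₂
      map_add' := fun _ _ => rfl
      map_smul' := fun _ _ => rfl }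
  refine ⟨N₁, N₂, B₁₁ ∘ₗ T ∘ₗ P, B₂₂ ∘ₗ T ∘ₗ P, fun x => (T (P x)).toBlocks₁₂, S, e, hN₁, hsum,
    hSu, fun x => ?_⟩
  have h21 : (T (P x)).toBlocks₂₁ = 0 := by
    ext i j
    rw [hT, Matrix.toBlocks₂₁, Matrix.of_apply, Matrix.reindex_apply, Matrix.submatrix_apply,
      Equiv.symm_symm, hzero, Matrix.zero_apply]
  have hblocks : fromBlocks ((B₁₁ ∘ₗ T ∘ₗ P) x) (T (P x)).toBlocks₁₂ 0 ((B₂₂ ∘ₗ T ∘ₗ P) x) =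
      T (P x) := by
    rw [← h21]
    exact Matrix.fromBlocks_toBlocks (T (P x))
  rw [hblocks, hT]
  have hre : Matrix.reindex e e (Matrix.reindex e.symm e.symm (S⁻¹ * (P x * S))) =
      S⁻¹ * (P x * S) := by
    simp only [Matrix.reindex_apply, Matrix.submatrix_submatrix, Equiv.symm_symm,
      Equiv.self_comp_symm, Matrix.submatrix_id_id]
  rw [hre, ← Matrix.mul_assoc, ← Matrix.mul_assoc, Matrix.mul_nonsing_inv S hSdet, Matrix.one_mul,
    Matrix.mul_assoc, Matrix.mul_nonsing_inv S hSdet, Matrix.mul_one]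

/-! ### Reduction of stub B to irreducible real-spectrum matrix spaces -/

/-- The closed nonnegative-spectrum cone of a pencil of `0 × 0` matrices is everything (size `0`).
[folklore] -/
theorem permanentalCones_realSpectrumShadow_zero (n : ℕ)
    (P : (Fin n → ℝ) →ₗ[ℝ] Matrix (Fin 0) (Fin 0) ℝ) :
    IsSpectrahedralShadowOfSize
      {x : Fin n → ℝ | ∀ τ : ℝ, 0 < τ → (P x + τ • (1 : Matrix (Fin 0) (Fin 0) ℝ)).det ≠ 0} 0 := by
  have h : {x : Fin n → ℝ | ∀ τ : ℝ, 0 < τ → (P x + τ • (1 : Matrix (Fin 0) (Fin 0) ℝ)).det ≠ 0} =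
      Set.univ := by
    ext x
    simp [Matrix.det_isEmpty]
  rw [h]
  exact isSpectrahedralShadowOfSize_univ_zero

/-- Arithmetic of the final bound: `N · 2^((log₂ N + c)^c) ≤ 2^((log₂ N + (c+2))^(c+2))`.
[folklore] -/
theorem permanentalCones_mul_qp_le_qp (N c : ℕ) :
    N * 2 ^ ((Nat.log 2 N + c) ^ c) ≤ 2 ^ ((Nat.log 2 N + (c + 2)) ^ (c + 2)) := by
  set L := Nat.log 2 N with hL
  have hN : N < 2 ^ (L + 1) := Nat.lt_pow_succ_log_self (by norm_num) N
  have h1 : (L + c) ^ c ≤ (L + c + 2) ^ c := Nat.pow_le_pow_left (by omega) c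
  have h2 : 1 ≤ (L + c + 2) ^ c := Nat.one_le_pow _ _ (by omega)
  have hE : L + 1 + (L + c) ^ c ≤ (L + (c + 2)) ^ (c + 2) := by
    have h3 : (L + (c + 2)) ^ (c + 2) = (L + c + 2) ^ c * ((L + c + 2) * (L + c + 2)) := by
      rw [show L + (c + 2) = L + c + 2 by ring, pow_add, pow_two]
    rw [h3]
    have h4 : L + c + 2 ≤ (L + c + 2) * (L + c + 2) := Nat.le_mul_self _
    nlinarith [h1, h2, h4]
  calc N * 2 ^ ((L + c) ^ c) ≤ 2 ^ (L + 1) * 2 ^ ((L + c) ^ c) :=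
        Nat.mul_le_mul_right _ hN.le
    _ = 2 ^ (L + 1 + (L + c) ^ c) := by rw [← pow_add]
    _ ≤ 2 ^ ((L + (c + 2)) ^ (c + 2)) := Nat.pow_le_pow_right (by norm_num) hE

/-- **Reduction of stub B to irreducible matrix spaces.** Suppose stub B holds — with some uniform
`c` — for all linear pencils `P` of real `N × N` matrices with only real eigenvalues that are
IRREDUCIBLE (no subspace `0 ≠ W ≠ ℝ^N` is invariant under every `P x`). Then stub B holds for all
real-spectrum pencils (conclusion = the registered signature of `stub_realSpectrumShadow`
verbatim, with `c + 2`). Proof: strong induction on `N` with the intermediate bound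
`N · 2^((log₂ N + c)^c)`; a reducible pencil is block upper triangular in an adapted basis
(`permanentalCones_exists_blockTriangular_of_invariant`), its diagonal pencils inherit the real
spectrum (`permanentalCones_realSpectrum_blockTriangular_iff`), and its cone is the intersection
of theirs, sizes adding (`permanentalCones_realSpectrumShadow_blockTriangular`). [folklore] -/
theorem permanentalCones_realSpectrumShadow_of_irreducible :
    (∃ c : ℕ, ∀ (n N : ℕ) (P : (Fin n → ℝ) →ₗ[ℝ] Matrix (Fin N) (Fin N) ℝ),
      (∀ (x : Fin n → ℝ) (z : ℂ),
        ((P x).map (algebraMap ℝ ℂ) - z • (1 : Matrix (Fin N) (Fin N) ℂ)).det = 0 → z.im = 0) →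
      (∀ W : Submodule ℝ (Fin N → ℝ), (∀ (x : Fin n → ℝ), ∀ v ∈ W, Matrix.mulVec (P x) v ∈ W) →
        W = ⊥ ∨ W = ⊤) →
      ∃ m ≤ 2 ^ ((Nat.log 2 N + c) ^ c),
        Literature.AlgebraicGeometry.HyperbolicPolynomials.IsSpectrahedralShadowOfSize
          {x : Fin n → ℝ | ∀ τ : ℝ, 0 < τ → (P x + τ • (1 : Matrix (Fin N) (Fin N) ℝ)).det ≠ 0} m) →
    ∃ c : ℕ, ∀ (n N : ℕ) (P : (Fin n → ℝ) →ₗ[ℝ] Matrix (Fin N) (Fin N) ℝ),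
      (∀ (x : Fin n → ℝ) (z : ℂ),
        ((P x).map (algebraMap ℝ ℂ) - z • (1 : Matrix (Fin N) (Fin N) ℂ)).det = 0 → z.im = 0) →
      ∃ m ≤ 2 ^ ((Nat.log 2 N + c) ^ c),
        ∃ (p : ℕ) (A : (Fin n → ℝ) × (Fin p → ℝ) →ₗ[ℝ] Matrix (Fin m) (Fin m) ℝ)
          (B : Matrix (Fin m) (Fin m) ℝ), ∀ x : Fin n → ℝ,
          (∀ τ : ℝ, 0 < τ → (P x + τ • (1 : Matrix (Fin N) (Fin N) ℝ)).det ≠ 0) ↔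
            ∃ y : Fin p → ℝ, (A (x, y) + B).PosSemidef := by
  intro hirr
  obtain ⟨c, hc⟩ := hirr
  -- intermediate bound `N · 2^((log₂ N + c)^c)` by strong induction on `N`
  have key : ∀ (N n : ℕ) (P : (Fin n → ℝ) →ₗ[ℝ] Matrix (Fin N) (Fin N) ℝ),
      (∀ (x : Fin n → ℝ) (z : ℂ),
        ((P x).map (algebraMap ℝ ℂ) - z • (1 : Matrix (Fin N) (Fin N) ℂ)).det = 0 → z.im = 0) →
      ∃ m ≤ N * 2 ^ ((Nat.log 2 N + c) ^ c), IsSpectrahedralShadowOfSize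
        {x : Fin n → ℝ | ∀ τ : ℝ, 0 < τ → (P x + τ • (1 : Matrix (Fin N) (Fin N) ℝ)).det ≠ 0} m := by
    intro N
    induction N using Nat.strong_induction_on with
    | _ N ih =>
      intro n P hP
      rcases Nat.eq_zero_or_pos N with rfl | hNpos
      · exact ⟨0, Nat.zero_le _, permanentalCones_realSpectrumShadow_zero n P⟩
      by_cases hred : ∃ W : Submodule ℝ (Fin N → ℝ),
          (∀ (x : Fin n → ℝ), ∀ v ∈ W, (P x) *ᵥ v ∈ W) ∧ W ≠ ⊥ ∧ W ≠ ⊤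
      · -- reducible: split along `W`
        obtain ⟨W, hWinv, hWbot, hWtop⟩ := hred
        obtain ⟨N₁, N₂, P₁, P₂, Q, S, e, hN₁, hsum, hSu, hPx⟩ :=
          permanentalCones_exists_blockTriangular_of_invariant P W hWinv
        have hN₁pos : 0 < N₁ := by
          rw [hN₁, pos_iff_ne_zero, Ne, Submodule.finrank_eq_zero]
          exact hWbot
        have hN₁lt : N₁ < N := by
          have := Submodule.finrank_lt hWtop
          rwa [Module.finrank_fin_fun, ← hN₁] at this
        have hN₂lt : N₂ < N := by omega
        have hreal := (permanentalCones_realSpectrum_blockTriangular_iff n N N₁ N₂ P P₁ P₂ Q S hSu e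
          hPx).1 hP
        obtain ⟨m₁, hm₁, h₁⟩ := ih N₁ hN₁lt n P₁ hreal.1
        obtain ⟨m₂, hm₂, h₂⟩ := ih N₂ hN₂lt n P₂ hreal.2
        refine ⟨m₁ + m₂, ?_, permanentalCones_realSpectrumShadow_blockTriangular n N N₁ N₂ P P₁ P₂
          Q S hSu e hPx h₁ h₂⟩
        have hl₁ : 2 ^ ((Nat.log 2 N₁ + c) ^ c) ≤ 2 ^ ((Nat.log 2 N + c) ^ c) :=
          Nat.pow_le_pow_right (by norm_num)
            (Nat.pow_le_pow_left (by have := Nat.log_mono_right (b := 2) hN₁lt.le; omega) c)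
        have hl₂ : 2 ^ ((Nat.log 2 N₂ + c) ^ c) ≤ 2 ^ ((Nat.log 2 N + c) ^ c) :=
          Nat.pow_le_pow_right (by norm_num)
            (Nat.pow_le_pow_left (by have := Nat.log_mono_right (b := 2) hN₂lt.le; omega) c)
        calc m₁ + m₂ ≤ N₁ * 2 ^ ((Nat.log 2 N₁ + c) ^ c) + N₂ * 2 ^ ((Nat.log 2 N₂ + c) ^ c) :=
              Nat.add_le_add hm₁ hm₂
          _ ≤ N₁ * 2 ^ ((Nat.log 2 N + c) ^ c) + N₂ * 2 ^ ((Nat.log 2 N + c) ^ c) :=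
              Nat.add_le_add (Nat.mul_le_mul_left _ hl₁) (Nat.mul_le_mul_left _ hl₂)
          _ = N * 2 ^ ((Nat.log 2 N + c) ^ c) := by rw [← Nat.add_mul, hsum]
      · -- irreducible: the hypothesis applies
        have hirr' : ∀ W : Submodule ℝ (Fin N → ℝ),
            (∀ (x : Fin n → ℝ), ∀ v ∈ W, Matrix.mulVec (P x) v ∈ W) → W = ⊥ ∨ W = ⊤ := by
          intro W hWinv
          by_contra hW
          exact hred ⟨W, hWinv, fun h => hW (Or.inl h), fun h => hW (Or.inr h)⟩
        obtain ⟨m, hm, h⟩ := hc n N P hP hirr'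
        exact ⟨m, hm.trans (Nat.le_mul_of_pos_left _ hNpos), h⟩
  refine ⟨c + 2, fun n N P hP => ?_⟩
  obtain ⟨m, hm, p, A, B, h⟩ := key N n P hP
  exact ⟨m, hm.trans (permanentalCones_mul_qp_le_qp N c), p, A, B, h⟩

/-- **Reduction of stub B to irreducible AND non-symmetrisable matrix spaces.** By the
symmetrisable case (`permanentalCones_realSpectrumShadow_symmetrizable`, size `N`) the
hypothesis of `permanentalCones_realSpectrumShadow_of_irreducible` only needs to be supplied for
pencils admitting NO positive definite common symmetriser. This is the exact open core of
stub B / crux #3 `HyperbolicDetShadow`: irreducible linear spaces of real matrices with only real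
eigenvalues that are not simultaneously symmetrisable. [folklore] -/
theorem permanentalCones_realSpectrumShadow_of_irreducible_nonsymmetrizable :
    (∃ c : ℕ, ∀ (n N : ℕ) (P : (Fin n → ℝ) →ₗ[ℝ] Matrix (Fin N) (Fin N) ℝ),
      (∀ (x : Fin n → ℝ) (z : ℂ),
        ((P x).map (algebraMap ℝ ℂ) - z • (1 : Matrix (Fin N) (Fin N) ℂ)).det = 0 → z.im = 0) →
      (∀ W : Submodule ℝ (Fin N → ℝ), (∀ (x : Fin n → ℝ), ∀ v ∈ W, Matrix.mulVec (P x) v ∈ W) →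
        W = ⊥ ∨ W = ⊤) →
      (¬ ∃ S : Matrix (Fin N) (Fin N) ℝ, S.PosDef ∧ ∀ x : Fin n → ℝ, (S * P x).IsSymm) →
      ∃ m ≤ 2 ^ ((Nat.log 2 N + c) ^ c),
        Literature.AlgebraicGeometry.HyperbolicPolynomials.IsSpectrahedralShadowOfSize
          {x : Fin n → ℝ | ∀ τ : ℝ, 0 < τ → (P x + τ • (1 : Matrix (Fin N) (Fin N) ℝ)).det ≠ 0} m) →
    ∃ c : ℕ, ∀ (n N : ℕ) (P : (Fin n → ℝ) →ₗ[ℝ] Matrix (Fin N) (Fin N) ℝ),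
      (∀ (x : Fin n → ℝ) (z : ℂ),
        ((P x).map (algebraMap ℝ ℂ) - z • (1 : Matrix (Fin N) (Fin N) ℂ)).det = 0 → z.im = 0) →
      ∃ m ≤ 2 ^ ((Nat.log 2 N + c) ^ c),
        ∃ (p : ℕ) (A : (Fin n → ℝ) × (Fin p → ℝ) →ₗ[ℝ] Matrix (Fin m) (Fin m) ℝ)
          (B : Matrix (Fin m) (Fin m) ℝ), ∀ x : Fin n → ℝ,
          (∀ τ : ℝ, 0 < τ → (P x + τ • (1 : Matrix (Fin N) (Fin N) ℝ)).det ≠ 0) ↔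
            ∃ y : Fin p → ℝ, (A (x, y) + B).PosSemidef := by
  rintro ⟨c, hc⟩
  apply permanentalCones_realSpectrumShadow_of_irreducible
  refine ⟨c + 1, fun n N P hP hirr => ?_⟩
  -- monotonicity of the bound in `c`, and `N ≤ 2^((log₂ N + c + 1)^(c+1))`
  have hmono : 2 ^ ((Nat.log 2 N + c) ^ c) ≤ 2 ^ ((Nat.log 2 N + (c + 1)) ^ (c + 1)) := by
    apply Nat.pow_le_pow_right (by norm_num)
    calc (Nat.log 2 N + c) ^ c ≤ (Nat.log 2 N + (c + 1)) ^ c := Nat.pow_le_pow_left (by omega) c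
      _ ≤ (Nat.log 2 N + (c + 1)) ^ (c + 1) := Nat.pow_le_pow_right (by omega) (by omega)
  have hN : N ≤ 2 ^ ((Nat.log 2 N + (c + 1)) ^ (c + 1)) := by
    have h1 : N < 2 ^ (Nat.log 2 N + 1) := Nat.lt_pow_succ_log_self (by norm_num) N
    have h2 : Nat.log 2 N + 1 ≤ (Nat.log 2 N + (c + 1)) ^ (c + 1) :=
      (by omega : Nat.log 2 N + 1 ≤ Nat.log 2 N + (c + 1)).trans (Nat.le_self_pow (by omega) _)
    exact h1.le.trans (Nat.pow_le_pow_right (by norm_num) h2)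
  by_cases hsym : ∃ S : Matrix (Fin N) (Fin N) ℝ, S.PosDef ∧ ∀ x : Fin n → ℝ, (S * P x).IsSymm
  · obtain ⟨S, hS, hSP⟩ := hsym
    exact ⟨N, hN, permanentalCones_realSpectrumShadow_symmetrizable n N P S hS hSP⟩
  · obtain ⟨m, hm, h⟩ := hc n N P hP hirr hsym
    exact ⟨m, hm.trans hmono, h⟩

end Summit.ValiantsHypothesis.ValiantsHypothesis.Theorems

end
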